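import Literature.MathematicalPhysics.QuantumFieldTheory.Balaban1983to89.B15Prop1SliceDatumCurvatureUniform
import Literature.MathematicalPhysics.QuantumFieldTheory.Balaban1983to89.B15Prop1LocalChartFromThm1AtBaseCentralTowerB

/-!
# `Balaban1983to89.B15Prop1SliceDatumCurvatureUniform` — [Balaban1985Variational] = «[15]», Sect. C (44)–(48) p. 285, (81)–(83) p. 290, Prop. 9 (190) p. 309; [Balaban1989LargeFieldII] — **BOND-DATUM EDITION** (`…B15Prop1SliceDatumCurvatureUniformB`, USED DECLARATIONS ONLY): the print-datum ([Balaban1984PropagatorsII] (2.3)) twins of the declarations of `B15Prop1SliceDatumCurvatureUniform` that N12's junction of record v14ᴸ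
uses with a datum-bearing statement (`analyticAt_sliceDatumModel`, `exists_uniform_sliceDatum_curvature_sq_bound`, `exists_uniform_sliceDatum_curvatureLetter`) — class (γ) of dag-n12-c's census-by-declaration v2 (bus [DAGN12C-G35], 2026-08-30).  GENERATOR (block-extracted from the
parent's tree bytes by HOME `lean/g35/gen/gen_blocks.py`): namespace `…B`, SAME names, `DetSet ↦ BDetSet` (F0a), `AgreeOn ↦ AgreeOnB`, `IsMinimizer ↦ IsMinimizerB`, `bondsOf (𝐁 j) ↦ 𝔅 j`, `constrCard ∕
constrEnum ∕ ConstrSet ∕ msChart ↦ …B` (lane `Node00/MultiScaleFibreChartB`), `IsCritOnFibre ∕ IsFibreChartNear ↦ …B`; proofs VERBATIM; the parent's other (datum-free) declarations REUSED by `open`.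

statement-level skeleton of published theorems with citation tags; proofs where landed; nothing here is a claim about
the Yang–Mills mass gap

Cell `pub-ymgap` (HUMAN RULINGS D-0062 ∕ D-0149), lane `pub-ymgap-dag-n12-c` g35 (R134 seat (a), N12 = [B15], s1, lane owner); `--kind proof --supports` K1⁹ `stmt-QuantumFields-27364`; count-neutral.
THEOREMS ONLY (0 `def`, 0 `instance`, 0 `sorry`).  HONESTY GUARD (director-ym №338 (5)): PURELY ADDITIVE — the parent stays landed and true on its own text; nothing in it is edited; no displayed
premise of any consumer is deleted or weakened; every hypothesis stays a hypothesis.  Nothing of Bałaban's analysis asserted; N12 NOT discharged; K0⁷ ∕ K1⁹ NOT closed; one finite 𝕋⁴ programme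
at fixed ε — nothing continuum ∕ ℝ⁴ ∕ OS; the Yang–Mills mass gap (Clay) is NOT proved by any of this.

PARENT's DOCSTRING (mathematics and citations; read `𝐁` as the bond datum `𝔅`):
# `Balaban1983to89.B15Prop1SliceDatumCurvatureUniform` — [Balaban1985Variational] = «[15]», Sect. C (44)–(48) p. 285, (81)–(83) p. 290, Prop. 9 (190) p. 309; [Balaban1989LargeFieldII]
# = «[LF-II]», (1.12)–(1.13) p. 359; [Balaban1988Convergent] = «[III]», (2.10)–(2.12) p. 256; [Balaban1987RG1] (0.4) p. 253, (0.21) p. 256: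
# ONE CHART-CURVATURE CONSTANT FOR THE SLICE DATUM COORDINATES `Φ₀` OVER A COMPACT GUARDED FAMILY OF BACKGROUNDS — the letter (R2) `‖D²Φ₀(0)[p̂,p̂]‖ ≤ M₂·Σ_b‖p b‖²` of the
# (β)-split's multiplier row (M), in `Φ₀` currency, with `M₂` uniform per height

Honest framing: statement-level skeleton of published theorems with citation tags; proofs where landed; nothing here is a claim about the
Yang–Mills mass gap.  Cell `pub-ymgap`, HUMAN RULING D-0062 (Track A), seat `pub-ymgap-dag-n12-c` g26 (lane owner N12 = [B15], strategy s1); count-neutral; N12 NOT discharged;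
finite 𝕋⁴ at fixed ε; nothing continuum ∕ OS ∕ mass-gap ∕ Clay.

WHY (lane memo `N12-UNIFORMITY-SPEC.md` §8; bus OFFER 2026-08-29T12:56Z).  After the (β) split the (J0′) producer's multiplier row (M) is produced per base field (dag-n12-w6's
`…N12MultiplierLetterOfClass`, `m := 8(d−1)·δ·B₁·M₂`) from the gauge row (δ) and ONE displayed analytic letter (R2): for the complex slice datum coordinates
`Φ₀ X i = logCoordC (W_{j_i}(c_i)⋆ · Ū^{j_i}(expMulC X ↑U₀)(c_i))` ([15] (47)–(48)), `‖D²Φ₀(0)[p̂,p̂]‖ ≤ M₂·Σ_b‖p b‖²` — and `m` is chosen BEFORE the base field, so `M₂` must be UNIFORM over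
the minimisers of one height.  Print: [15] Sect. C (46) «|D²…| ≤ O(1)» and (81)–(83) p. 290 (the second-order term of the straightening map); [LF-II] (1.12)–(1.13) p. 359.  THIS FILE proves the
uniform bound over any COMPACT family of backgrounds that are (0.4)-guarded along the tower of every constrained bond: `Φ₀` is the restriction to the slice of the AMBIENT model
`G (V, A) X i = logCoordC (A_i · Ū^{j_i}(expMulC X V)(c_i))` at the parameter `a(U₀) = (↑U₀, (↑Ū^{j_i}(U₀)(c_i))⋆)` (the constraint `M˙(U₀) = W` puts the datum there), `G` is JOINTLY
ℂ-analytic in `((V, A), X)` at `(a(U₀), 0)` (the holomorphic iterate is analytic at tower-guarded fields — `B15AveragingHolomorphicLocalAnalytic`; the chart is entire; `logCoordC` is analytic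
at `A_i · Ū^{j_i}(↑U₀)(c_i) = u⋆u = 1`; no `star` inside the model — the adjoint datum is a PARAMETER), `a` is continuous on the family (the guarded averages are,
`B15Prop1LocalChartFromThm1AtBaseCentralTower.continuousAt_datum_of_guardOn`), so `a(T)` is compact and one constant bounds the second derivative (the `ℂ`-twin of NODE 00's
`MultiScaleFibreChartCurvatureUniform.exists_sq_bound_on_compact_of_contDiffAt_two`).  The record's compact family (the closed plaquette-small set around NODE 00's class) is supplied by
`Summits/…/BalabanUVNodesN12SliceDatumCurvatureOfClass`.

CONTENTS (theorems only; no `def`, no `instance`, no `sorry`).  §1 ★ `exists_sq_bound_on_compact_of_contDiffAt_two_complex`, `fderiv_fderiv_comp_clm_apply` (second derivative of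
`f ∘ L`); §2 `analyticAt_expMulC` (jointly), `expMulC_zero`, ★★ `analyticAt_sliceDatumModel`; §3 ★★★ `exists_uniform_sliceDatum_curvature_sq_bound` (`‖D²Φ₀(0)(v,v)‖ ≤ M₂‖v‖²` on a
compact guarded family), ★★★ `exists_uniform_sliceDatum_curvatureLetter` (dag-n12-w6's `hcurv` VERBATIM: `p̂ = cplxVec p ∈ S`, kernel hypothesis carried, `Σ_b‖p b‖²` on the right).
HONEST SCOPE: finite-dimensional calculus + compactness; `M₂` is an EXISTENCE constant per (torus, `𝔹`, `k`, family) — print's volume-uniform `O(1)` NOT claimed (U4 grade); nothing of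
Bałaban's estimates asserted; count-neutral; N12 NOT discharged; the YM mass gap (Clay) is NOT proved by any of this — R4 closes only the conditional finite-𝕋⁴ rung `BalabanLadder.UV`.
-/


noncomputable section

namespace Literature.MathematicalPhysics.QuantumFieldTheory.Balaban1983to89.B15Prop1SliceDatumCurvatureUniformB

open B15Prop1SliceDatumCurvatureUniform


open Set Metric Filter
open scoped Topology BigOperators
open Literature.MathematicalPhysics.QuantumFieldTheory.Balaban1983to89.Node00 (SU coeField coeField_apply SmallBelow ConstrSetB constrCardB constrEnumB star_coe_mul_coe_SU)
open B15AveragingHolomorphic (iterMh loopMh)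
open B15AveragingHolomorphicLocalAnalytic (analyticAt_iterMh_apply_of_polydiscOn polydiscOn_of_guardOn)
open B15AveragingHolomorphicTowerRegion (preimage_blockIter_saturated self_mem_bondsIn_towerRegion iterMh_coeField_apply_eq_of_guardOn_towerRegion)
open B15AveragingAnalytic (analyticAt_logCoordC)
open B15SU2ChartHolomorphic (genE expPointC expMulC logCoordC)
open B15Prop1StateChartSU2 (analyticAt_expPointC)
open B15Prop1DatumCoordinates (expPointC_zero)
open B15Prop1LocalChartFromThm1AtBaseCentralTowerB (continuousAt_datum_of_guardOn)
open B15Prop1ClassOpenAtRecord (isInducing_coeField)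
open B15Prop1AnalyticExtClause (cplxVec norm_cplxVec)
open B15Prop1ChartCalculusSU2 (E3)
open ExpMeanLog (expMeanLogSU deltaSU)
open BlockAveraging (Small Idx blockAvg)
open B10Eq42TorusConstraint (bondsIn)
open B14.Eq22Determines (blockIter)
open T4CubeChartGnomonic (SU2)
open T4Continuum B15DeterminingSets B15DeterminingSetsB GaugeField
open scoped Matrix.Norms.L2Operator



section
variable {P : Params}

/-- ★★ **THE AMBIENT COORDINATE MODEL IS JOINTLY ℂ-ANALYTIC** in (background `V`, adjoint data `A`, coordinates `X`) at `((↑U, A), 0)`: for a determining set `𝔅` read below `k ≤ m + K`,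
an `SU(2)` field `U` that is (0.4)-guarded along the tower of every constrained bond, and adjoint data `A` with `A_i · Ū^{j_i}(↑U)(c_i) = 1`, the map
`((V, A), X) ↦ (i ↦ logCoordC (A_i · Ū^{j_i}(expMulC X V)(c_i)))` is analytic (the holomorphic iterate is analytic at tower-guarded fields, `B15AveragingHolomorphicLocalAnalytic`; the chart
is entire; `logCoordC` is analytic at `1`). [cite: Balaban1985Variational, Sect. C (47)–(48) p.285, Prop. 9 (190) p.309; Balaban1987RG1, (0.4) p.253, (0.21) p.256] -/
theorem analyticAt_sliceDatumModel (𝔅 : BDetSet P) (k : ℕ) (hk : k ≤ P.m + P.K) {U : GaugeField P 0 SU2}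
    (hg : ∀ i : Fin (constrCardB 𝔅 k), ∀ j', j' < (((constrEnumB 𝔅 k).symm i).1 : ℕ) → ∀ c' : PBond P (j' + 1),
      c' ∈ bondsIn (j' + 1) (blockIter (((constrEnumB 𝔅 k).symm i).1 : ℕ) ⁻¹'
        ({((constrEnumB 𝔅 k).symm i).2.1.src, ((constrEnumB 𝔅 k).symm i).2.1.tgt} : Set (Site P ((constrEnumB 𝔅 k).symm i).1))) →
        Small expMeanLogSU (Averaging.iter (fun j => blockAvg (P := P) (j := j) expMeanLogSU) j' U) c')
    {A : Fin (constrCardB 𝔅 k) → Matrix (Fin 2) (Fin 2) ℂ}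
    (hA : ∀ i, A i * iterMh ((constrEnumB 𝔅 k).symm i).1 (coeField U) ((constrEnumB 𝔅 k).symm i).2.1 = 1) :
    AnalyticAt ℂ (Function.uncurry fun (a : (PBond P 0 → Matrix (Fin 2) (Fin 2) ℂ) × (Fin (constrCardB 𝔅 k) → Matrix (Fin 2) (Fin 2) ℂ))
        (X : VecField P 0 (EuclideanSpace ℂ (Fin 3))) =>
      fun i : Fin (constrCardB 𝔅 k) => logCoordC (a.2 i * iterMh ((constrEnumB 𝔅 k).symm i).1 (expMulC X a.1) ((constrEnumB 𝔅 k).symm i).2.1))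
      ((coeField U, A), 0) := by
  refine analyticAt_pi_iff.2 fun i => ?_
  set s := (constrEnumB 𝔅 k).symm i with hs
  have hj : (s.1 : ℕ) ≤ P.m + P.K := (Nat.le_of_lt_succ s.1.2).trans hk
  -- the three coordinate projections of the parameter space
  set Ω := ((PBond P 0 → Matrix (Fin 2) (Fin 2) ℂ) × (Fin (constrCardB 𝔅 k) → Matrix (Fin 2) (Fin 2) ℂ)) × VecField P 0 (EuclideanSpace ℂ (Fin 3))
  have hV : AnalyticAt ℂ (fun q : Ω => q.1.1) ((coeField U, A), 0) := analyticAt_fst.comp analyticAt_fst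
  have h12 : AnalyticAt ℂ (fun q : Ω => q.1.2) ((coeField U, A), 0) := analyticAt_snd.comp analyticAt_fst
  have hAi : AnalyticAt ℂ (fun q : Ω => q.1.2 i) ((coeField U, A), 0) :=
    ((ContinuousLinearMap.proj (R := ℂ) (φ := fun _ : Fin (constrCardB 𝔅 k) => Matrix (Fin 2) (Fin 2) ℂ) i).analyticAt _).comp h12
  have hX : AnalyticAt ℂ (fun q : Ω => q.2) ((coeField U, A), 0) := analyticAt_snd
  -- the chart, jointly
  have hE : AnalyticAt ℂ (fun q : Ω => expMulC q.2 q.1.1) ((coeField U, A), 0) := analyticAt_expMulC hX hV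
  have hE0 : (fun q : Ω => expMulC q.2 q.1.1) ((coeField U, A), 0) = coeField U := by
    show expMulC 0 (coeField U) = coeField U
    exact expMulC_zero _
  -- the holomorphic iterate at the tower-guarded field
  have hpoly := polydiscOn_of_guardOn (N := 2) (s.1 : ℕ) hj (preimage_blockIter_saturated hj _) (hg i) (V₀ := coeField U) fun _ _ => rfl
  have hδ : deltaSU (Fin 2) ≤ 1 := by unfold deltaSU; exact (min_le_left _ _).trans (by norm_num)
  have hIt : AnalyticAt ℂ (fun V : PBond P 0 → Matrix (Fin 2) (Fin 2) ℂ => iterMh (s.1 : ℕ) V s.2.1) (coeField U) :=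
    analyticAt_iterMh_apply_of_polydiscOn (s.1 : ℕ) hj (preimage_blockIter_saturated hj _)
      (fun j' hj' c' hc' ι => (hpoly j' hj' c' hc' ι).trans_le hδ) s.2.1 (self_mem_bondsIn_towerRegion hj _)
  have hIt' : AnalyticAt ℂ (fun q : Ω => iterMh (s.1 : ℕ) (expMulC q.2 q.1.1) s.2.1) ((coeField U, A), 0) := hIt.comp_of_eq hE hE0
  -- the product with the adjoint datum and the logarithmic coordinates at `1`
  have hM : AnalyticAt ℂ (fun q : Ω => q.1.2 i * iterMh (s.1 : ℕ) (expMulC q.2 q.1.1) s.2.1) ((coeField U, A), 0) := hAi.mul hIt'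
  have hM0 : (fun q : Ω => q.1.2 i * iterMh (s.1 : ℕ) (expMulC q.2 q.1.1) s.2.1) ((coeField U, A), 0) = 1 := by
    show A i * iterMh (s.1 : ℕ) (expMulC 0 (coeField U)) s.2.1 = 1
    rw [expMulC_zero]
    exact hA i
  have hL : AnalyticAt ℂ logCoordC (1 : Matrix (Fin 2) (Fin 2) ℂ) := analyticAt_logCoordC (by rw [sub_self, norm_zero]; exact one_pos)
  exact hL.comp_of_eq hM hM0

end

section
variable {P : Params}

/-- ★★★ **ONE SLICE-DATUM CURVATURE CONSTANT FOR A COMPACT GUARDED FAMILY OF BACKGROUNDS.**  Objects: a determining set `𝔅` read below `k ≤ m + K`; a COMPACT set `T` of `SU(2)`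
configurations each of which is (0.4)-guarded along the tower of every constrained bond of `𝔅` (at the record: the closed plaquette-small set around NODE 00's class, see
`Summits/…/BalabanUVNodesN12SliceDatumCurvatureOfClass`).  CONCLUSION: there is `M₂ ≥ 0` such that for EVERY `U₀ ∈ T`, EVERY multi-scale datum `W` on whose fibre `U₀` lies
(`M˙(U₀) = W` on `𝔅`), EVERY complex slice `S` and the slice datum coordinates `Φ₀ : S → (𝔅 → ℂ³)` by their formula, `‖D²Φ₀(0)(v,v)‖ ≤ M₂·‖v‖²` for all `v ∈ S`.  Proof: `Φ₀` is
§2's jointly analytic model at the parameter `a(U₀) = (↑U₀, (↑Ū^{j_i}(U₀)(c_i))⋆)` restricted to `S` (`fderiv_fderiv_comp_clm_apply`); `a` is continuous on `T` (the averages are, where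
guarded: `B15Prop1LocalChartFromThm1AtBaseCentralTower.continuousAt_datum_of_guardOn`), so `a(T)` is compact and §1 gives one constant.  LOCATED: `M₂` depends on `(P, 𝔅, k, T)` — a
per-height EXISTENCE constant (U4 grade), NOT print's volume-uniform `O(1)` of [15] (46).
[cite: Balaban1985Variational, Sect. C (44)–(48) p.285, (81)–(83) p.290, Prop. 9 (190) p.309; Balaban1989LargeFieldII, (1.12)–(1.13) p.359; Balaban1988Convergent, (2.10)–(2.12) p.256; Balaban1987RG1, (0.4) p.253] -/
theorem exists_uniform_sliceDatum_curvature_sq_bound (𝔅 : BDetSet P) (k : ℕ) (hk : k ≤ P.m + P.K)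
    {T : Set (GaugeField P 0 SU2)} (hT : IsCompact T)
    (hgT : ∀ U ∈ T, ∀ i : Fin (constrCardB 𝔅 k), ∀ j', j' < (((constrEnumB 𝔅 k).symm i).1 : ℕ) → ∀ c' : PBond P (j' + 1),
      c' ∈ bondsIn (j' + 1) (blockIter (((constrEnumB 𝔅 k).symm i).1 : ℕ) ⁻¹'
        ({((constrEnumB 𝔅 k).symm i).2.1.src, ((constrEnumB 𝔅 k).symm i).2.1.tgt} : Set (Site P ((constrEnumB 𝔅 k).symm i).1))) →
        Small expMeanLogSU (Averaging.iter (fun j => blockAvg (P := P) (j := j) expMeanLogSU) j' U) c') :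
    ∃ M₂ : ℝ, 0 ≤ M₂ ∧ ∀ U₀ ∈ T, ∀ W : MSField P SU2, AgreeOnB 𝔅 (avgFamily (fun j => blockAvg (P := P) (j := j) expMeanLogSU) U₀) W →
      ∀ (S : Submodule ℂ (VecField P 0 (EuclideanSpace ℂ (Fin 3)))) (Φ₀ : S → Fin (constrCardB 𝔅 k) → EuclideanSpace ℂ (Fin 3)),
        (∀ (X : S) i, Φ₀ X i = logCoordC (star ((W ((constrEnumB 𝔅 k).symm i).1 ((constrEnumB 𝔅 k).symm i).2.1 : SU2) : Matrix (Fin 2) (Fin 2) ℂ) *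
          iterMh ((constrEnumB 𝔅 k).symm i).1 (expMulC (X : VecField P 0 (EuclideanSpace ℂ (Fin 3))) (coeField U₀)) ((constrEnumB 𝔅 k).symm i).2.1)) →
        ∀ v : S, ‖fderiv ℂ (fderiv ℂ Φ₀) 0 v v‖ ≤ M₂ * ‖v‖ ^ 2 := by
  -- the parameter map `a(U) = (↑U, (↑Ū^{j_i}(U)(c_i))⋆)` and its compact image
  let a : GaugeField P 0 SU2 → (PBond P 0 → Matrix (Fin 2) (Fin 2) ℂ) × (Fin (constrCardB 𝔅 k) → Matrix (Fin 2) (Fin 2) ℂ) := fun U =>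
    (coeField U, fun i => star (((avgFamily (fun j => blockAvg (P := P) (j := j) expMeanLogSU) U ((constrEnumB 𝔅 k).symm i).1
      ((constrEnumB 𝔅 k).symm i).2.1 : SU2) : Matrix (Fin 2) (Fin 2) ℂ)))
  have hcoe : Continuous (coeField : GaugeField P 0 SU2 → PBond P 0 → Matrix (Fin 2) (Fin 2) ℂ) := isInducing_coeField.continuous
  have ha : ContinuousOn a T := fun U hU => by
    refine ContinuousAt.continuousWithinAt (ContinuousAt.prodMk hcoe.continuousAt ?_)
    exact (continuous_star.continuousAt).comp (continuousAt_datum_of_guardOn 𝔅 k hk (hgT U hU))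
  have hS : IsCompact (a '' T) := hT.image_of_continuousOn ha
  -- the model is `C²` at every parameter of the image
  let G : (PBond P 0 → Matrix (Fin 2) (Fin 2) ℂ) × (Fin (constrCardB 𝔅 k) → Matrix (Fin 2) (Fin 2) ℂ) → VecField P 0 (EuclideanSpace ℂ (Fin 3)) →
      Fin (constrCardB 𝔅 k) → EuclideanSpace ℂ (Fin 3) := fun p X i =>
    logCoordC (p.2 i * iterMh ((constrEnumB 𝔅 k).symm i).1 (expMulC X p.1) ((constrEnumB 𝔅 k).symm i).2.1)
  have hA : ∀ U ∈ T, ∀ i, (a U).2 i * iterMh ((constrEnumB 𝔅 k).symm i).1 (coeField U) ((constrEnumB 𝔅 k).symm i).2.1 = 1 := fun U hU i => by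
    have hj : ((((constrEnumB 𝔅 k).symm i).1 : ℕ)) ≤ P.m + P.K := (Nat.le_of_lt_succ ((constrEnumB 𝔅 k).symm i).1.2).trans hk
    show star (((avgFamily (fun j => blockAvg (P := P) (j := j) expMeanLogSU) U ((constrEnumB 𝔅 k).symm i).1 ((constrEnumB 𝔅 k).symm i).2.1 : SU2) :
        Matrix (Fin 2) (Fin 2) ℂ)) * iterMh ((constrEnumB 𝔅 k).symm i).1 (coeField U) ((constrEnumB 𝔅 k).symm i).2.1 = 1
    rw [iterMh_coeField_apply_eq_of_guardOn_towerRegion hj _ (hgT U hU i)]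
    exact star_coe_mul_coe_SU _
  have hG : ∀ p ∈ a '' T, ContDiffAt ℂ 2 (Function.uncurry G) (p, 0) := by
    rintro _ ⟨U, hU, rfl⟩
    exact (analyticAt_sliceDatumModel 𝔅 k hk (hgT U hU) (hA U hU)).contDiffAt
  obtain ⟨C, hC, hbound⟩ := exists_sq_bound_on_compact_of_contDiffAt_two_complex G hS hG
  refine ⟨C, hC, fun U₀ hU₀ W hW S Φ₀ hΦ₀ v => ?_⟩
  -- `Φ₀` is the model at `a U₀` restricted to the slice
  have hfun : Φ₀ = G (a U₀) ∘ S.subtypeL := by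
    funext X; funext i
    rw [hΦ₀ X i, ← hW _ _ ((constrEnumB 𝔅 k).symm i).2.2]
    rfl
  have h2 : ContDiffAt ℂ 2 (G (a U₀)) 0 := by
    have h := hG _ ⟨U₀, hU₀, rfl⟩
    exact h.comp 0 (contDiffAt_const.prodMk contDiffAt_id)
  rw [hfun, fderiv_fderiv_comp_clm_apply S.subtypeL h2 v v]
  have hn : ‖v‖ = ‖(S.subtypeL v : VecField P 0 (EuclideanSpace ℂ (Fin 3)))‖ := rfl
  rw [hn]
  exact hbound (a U₀) ⟨U₀, hU₀, rfl⟩ (S.subtypeL v)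

end

section
variable {P : Params}

/-- ★★★ **THE LETTER (R2) OF THE (M)-ROW PRODUCER, INHABITED ON A COMPACT GUARDED FAMILY** — dag-n12-w6's displayed `hcurv` VERBATIM (`p̂ = cplxVec p ∈ S`, kernel hypothesis carried and
unused): `‖D²Φ₀(0)[p̂,p̂]‖ ≤ M₂·Σ_b‖p b‖²` with the constant of `exists_uniform_sliceDatum_curvature_sq_bound` (`‖p̂‖² = ‖p‖² ≤ Σ_b‖p b‖²`, sup norm against `ℓ²`).
[cite: Balaban1985Variational, Sect. C (44)–(48) p.285, (81)–(83) p.290; Balaban1989LargeFieldII, (1.12)–(1.13) p.359; Balaban1988Convergent, (2.10)–(2.12) p.256] -/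
theorem exists_uniform_sliceDatum_curvatureLetter (𝔅 : BDetSet P) (k : ℕ) (hk : k ≤ P.m + P.K)
    {T : Set (GaugeField P 0 SU2)} (hT : IsCompact T)
    (hgT : ∀ U ∈ T, ∀ i : Fin (constrCardB 𝔅 k), ∀ j', j' < (((constrEnumB 𝔅 k).symm i).1 : ℕ) → ∀ c' : PBond P (j' + 1),
      c' ∈ bondsIn (j' + 1) (blockIter (((constrEnumB 𝔅 k).symm i).1 : ℕ) ⁻¹'
        ({((constrEnumB 𝔅 k).symm i).2.1.src, ((constrEnumB 𝔅 k).symm i).2.1.tgt} : Set (Site P ((constrEnumB 𝔅 k).symm i).1))) →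
        Small expMeanLogSU (Averaging.iter (fun j => blockAvg (P := P) (j := j) expMeanLogSU) j' U) c') :
    ∃ M₂ : ℝ, 0 ≤ M₂ ∧ ∀ U₀ ∈ T, ∀ W : MSField P SU2, AgreeOnB 𝔅 (avgFamily (fun j => blockAvg (P := P) (j := j) expMeanLogSU) U₀) W →
      ∀ (S : Submodule ℂ (VecField P 0 (EuclideanSpace ℂ (Fin 3)))) (Φ₀ : S → Fin (constrCardB 𝔅 k) → EuclideanSpace ℂ (Fin 3)),
        (∀ (X : S) i, Φ₀ X i = logCoordC (star ((W ((constrEnumB 𝔅 k).symm i).1 ((constrEnumB 𝔅 k).symm i).2.1 : SU2) : Matrix (Fin 2) (Fin 2) ℂ) *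
          iterMh ((constrEnumB 𝔅 k).symm i).1 (expMulC (X : VecField P 0 (EuclideanSpace ℂ (Fin 3))) (coeField U₀)) ((constrEnumB 𝔅 k).symm i).2.1)) →
        ∀ (p : VecField P 0 E3) (hp : cplxVec p ∈ S), fderiv ℂ Φ₀ 0 ⟨cplxVec p, hp⟩ = 0 →
          ‖fderiv ℂ (fderiv ℂ Φ₀) 0 ⟨cplxVec p, hp⟩ ⟨cplxVec p, hp⟩‖ ≤ M₂ * ∑ b : PBond P 0, ‖p b‖ ^ 2 := by
  obtain ⟨M₂, hM₂, h⟩ := exists_uniform_sliceDatum_curvature_sq_bound 𝔅 k hk hT hgT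
  refine ⟨M₂, hM₂, fun U₀ hU₀ W hW S Φ₀ hΦ₀ p hp _ => (h U₀ hU₀ W hW S Φ₀ hΦ₀ ⟨cplxVec p, hp⟩).trans ?_⟩
  refine mul_le_mul_of_nonneg_left ?_ hM₂
  -- `‖p̂‖² = ‖p‖² ≤ Σ_b ‖p b‖²` (sup norm against `ℓ²`)
  have hn : ‖(⟨cplxVec p, hp⟩ : S)‖ = ‖p‖ := by rw [Submodule.coe_norm]; exact norm_cplxVec p
  rw [hn]
  have hle : ‖p‖ ≤ Real.sqrt (∑ b, ‖p b‖ ^ 2) :=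
    (pi_norm_le_iff_of_nonneg (Real.sqrt_nonneg _)).2 fun b =>
      Real.le_sqrt_of_sq_le (Finset.single_le_sum (f := fun b => ‖p b‖ ^ 2) (fun b _ => sq_nonneg _) (Finset.mem_univ b))
  calc ‖p‖ ^ 2 ≤ Real.sqrt (∑ b, ‖p b‖ ^ 2) ^ 2 := pow_le_pow_left₀ (norm_nonneg _) hle 2
    _ = ∑ b, ‖p b‖ ^ 2 := Real.sq_sqrt (Finset.sum_nonneg fun b _ => sq_nonneg _)

end

end Literature.MathematicalPhysics.QuantumFieldTheory.Balaban1983to89.B15Prop1SliceDatumCurvatureUniformB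

end
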